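import Mathlib.Computability.Encoding
import Mathlib.Computability.Language
import Mathlib.Data.Set.BoolIndicator
import Mathlib.Data.List.OfFn
import Literature.Computability.Complexity.TimeBounds
import HarnessLib

-- provenance: harness21/H21/H21/Prelude/CplxCore/BoolEncodings.lean @ 8dffb85 (interim HEAD d8f2665); M5 mechanical rewrite
/-!
# Complexity core: Boolean encodings and pairing

Trunk `CplxCore`, concept C2 (`BoolEncodings`): the encoding conventions by which math-level
decision problems (numbers, tuples, lists, bit vectors, …) become languages over Cook's alphabet
`Σ = {0,1}`, i.e. `Language Bool`.

Mathlib (`Mathlib/Computability/Encoding.lean`) provides the structure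
`Computability.Encoding α Γ` (encode/decode/`decode_encode`), `Encoding.encode_injective`, and
the concrete encodings `encodingNatBool` (binary), `unaryEncodingNat`
(`unaryEncodeNat`/`unaryDecodeNat`/`unary_decode_encode_nat`), `encodingBoolBool` and
`encodingList Bool` (the identity string encoding); we reuse all of these. Mathlib's product
encoding `encodingProd ea eb` lives over the *sum alphabet* `Γ₁ ⊕ Γ₂`, which is useless for
classes of `Language Bool`; hence this file provides a Bool-valued self-delimiting pairing
`boolPair` (double every bit of the first component, separator `01`) and the combinators

* `Computability.Encoding.pairBool`, `.listBool`, `.sigmaBool`, `.optionBool`, `.sumBool`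
  (deliberate dot-notation extensions in Mathlib's `Computability.Encoding` namespace, each with
  a real `decode_encode` proof);
* concrete encodings `encodingIntBool`, `encodingFinBool n`, `encodingBitVec n`,
  `encodingListNatBool` (named so because `Literature.Computability.Cryptography.encodingListNat` exists over `Option Bool`);
* `Computability.Encoding.toLanguage e S := e.encode '' S` (math set ↦ language) and
  `Language.sliceFn L n : (Fin n → Bool) → Bool` (the `n`-th slice of a language as a Boolean
  function, used for circuits and algebrization);
* sanity statements that pairing and the projections are polynomial-time (`sorry`d; routine
  machine constructions).

## Design notes

* Universes `α β : Type` (Mathlib's TM2 API is `Type`-monomorphic).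
* `encodeNat 0 = []`, so a bare `encodeNat` suffix is never used as a delimiter-free field;
  every composite goes through `boolPair`.
* `boolUnpair` returns the junk value `([], [])` on malformed input (no separator found); the
  decoders then fail or return junk, which is irrelevant since only `decode_encode` matters.
* Graph/finset/matrix encodings are in `GraphEncodings.lean` (C2b).

## References

* S. Arora, B. Barak, *Computational Complexity: A Modern Approach*, CUP 2009, §0.1
  ("Representing objects as strings", pairing `⟨x, y⟩`), §1.2, §6.1 (Boolean slices).
* M. Sipser, *Introduction to the Theory of Computation*, 3rd ed., §3.3 (encodings `⟨·⟩`).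
* Mathlib `Computability.Encoding`, `Computability.encodingProd`.
-/

namespace Literature.Computability.Complexity

open _root_.Computability

variable {α β : Type}

/-! ### Self-delimiting pairing of bit strings -/

/-- The Bool-valued pairing `⟨x, y⟩` of two bit strings: every bit of `x` is doubled, then the
separator `false, true` (i.e. `01`), then `y` verbatim. Self-delimiting in the first component,
of length `2|x| + 2 + |y|`. [Arora–Barak 2009, §0.1 (pairing of strings)] [cite: AroraBarak2009, §0.1 (pairing of strings] -/
def boolPair (x y : List Bool) : List Bool :=
  (x.flatMap fun b => [b, b]) ++ [false, true] ++ y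

/-- Inverse of `boolPair`: read bits two at a time; equal pairs `bb` contribute `b` to the first
component, the first unequal pair `01` ends it and the rest is the second component. Malformed
inputs (odd prefix without separator, or a `10` pair) yield the junk value `([], [])` /
truncated output. [Arora–Barak 2009, §0.1] [cite: AroraBarak2009, §0.1] -/
def boolUnpair : List Bool → List Bool × List Bool
  | b :: b' :: rest =>
    if b = b' then ((boolUnpair rest).1.cons b, (boolUnpair rest).2)
    else if b' = true then ([], rest) else ([], [])
  | _ => ([], [])

/-- Length of a pair: `|⟨x, y⟩| = 2|x| + 2 + |y|`. [Arora–Barak 2009, §0.1] [cite: AroraBarak2009, §0.1] -/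
@[simp] theorem length_boolPair (x y : List Bool) :
    (boolPair x y).length = 2 * x.length + 2 + y.length := by
  induction x with
  | nil => simp only [boolPair, List.flatMap_nil, List.nil_append, List.length_append,
      List.length_cons, List.length_nil]
  | cons b x ih =>
    simp only [boolPair, List.flatMap_cons, List.append_assoc, List.length_append,
      List.length_cons, List.length_nil, List.length_flatMap] at ih ⊢
    omega

/-- `boolUnpair` is a left inverse of `boolPair`. [Arora–Barak 2009, §0.1] [cite: AroraBarak2009, §0.1] -/
@[simp] theorem boolUnpair_boolPair (x y : List Bool) : boolUnpair (boolPair x y) = (x, y) := by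
  induction x with
  | nil => simp [boolPair, boolUnpair]
  | cons b x ih =>
    simp only [boolPair, List.append_assoc, List.cons_append, List.nil_append] at ih
    simp [boolPair, boolUnpair, ih]

/-- The pairing `boolPair` is injective (as an uncurried function on pairs of strings).
[Arora–Barak 2009, §0.1] [cite: AroraBarak2009, §0.1] -/
theorem boolPair_injective : Function.Injective (Function.uncurry boolPair) := by
  rintro ⟨x, y⟩ ⟨x', y'⟩ h
  have := congr_arg boolUnpair h
  simpa [Function.uncurry] using this

/-- The components of the pair decoder are short: `2 |fst| + |snd| ≤ |w|` on every string
(`= |w| - 2` on well-formed pairs `boolPair x y`: the separator costs two symbols). Canonical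
home of this bound: the byte-identical copies `OracleCompose.length_boolUnpair_le`
(`CookReducibilityTransitive.lean`) and the private `length_boolUnpair_le'` (`StackBricks.lean`)
are to be retired into aliases of this one; the weaker `Literature.Computability.Complexity.length_boolUnpair_fst_le`
(`NondeterministicProofs.lean`, `|fst| ≤ |w|`) and `Literature.Computability.Cryptography.length_boolUnpair_le`
(`ShorOrdPost.lean`, `|fst| + |snd| ≤ |w|`) are corollaries. Named apart from them so that files
opening those namespaces stay unambiguous. [Arora–Barak 2009, §0.1] [folklore] -/
theorem length_boolUnpair_parts_le : ∀ w : List Bool,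
    2 * (boolUnpair w).1.length + (boolUnpair w).2.length ≤ w.length
  | [] => by simp [boolUnpair]
  | [b] => by simp [boolUnpair]
  | b :: b' :: rest => by
    have ih := length_boolUnpair_parts_le rest
    by_cases h : b = b'
    · subst h
      simp only [boolUnpair, if_true, List.length_cons]
      omega
    · cases b'
      · simp [boolUnpair, h]
      · simp [boolUnpair, h]; omega

/-- Fuel-indexed decoder for `Computability.Encoding.listBool`: `listBoolDecode e n w` splits
off `n` components of `w` with `boolUnpair` and decodes each with `e`. [H21 design C2] [folklore] -/
def listBoolDecode (e : Encoding α Bool) : ℕ → List Bool → Option (List α)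
  | 0, _ => some []
  | n + 1, w => do
    let a ← e.decode (boolUnpair w).1
    let l ← listBoolDecode e n (boolUnpair w).2
    return a :: l

/-- Decoder for `Computability.Encoding.sigmaBool`: decode the payload `v` with the encoding at
the (already decoded) index `m` and tag it with `m`. [H21 design C2] [folklore] -/
def sigmaBoolDecode {F : ℕ → Type} (e : ∀ n : ℕ, Encoding (F n) Bool) (m : ℕ) (v : List Bool) :
    Option (Σ n, F n) :=
  ((e m).decode v).map (Sigma.mk m)

end Literature.Computability.Complexity

/-! ### Encoding combinators (dot-notation extensions of `Computability.Encoding`) -/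

namespace Computability.Encoding

open Literature.Computability.Complexity

variable {α β : Type}

/-- Product encoding over `Bool`: `(a, b) ↦ boolPair (ea.encode a) (eb.encode b)`.
Replaces Mathlib's `encodingProd` (alphabet `Γ₁ ⊕ Γ₂`) for `Language Bool`-valued classes.
Deliberate dot-notation extension of `Computability.Encoding`. [Arora–Barak 2009, §0.1] [cite: AroraBarak2009, §0.1] -/
def pairBool (ea : Encoding α Bool) (eb : Encoding β Bool) : Encoding (α × β) Bool where
  encode p := boolPair (ea.encode p.1) (eb.encode p.2)
  decode w := do
    let a ← ea.decode (boolUnpair w).1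
    let b ← eb.decode (boolUnpair w).2
    return (a, b)
  decode_encode p := by simp [boolUnpair_boolPair, ea.decode_encode, eb.decode_encode]

/-- List encoding over `Bool`: a list `l` is encoded as
`boolPair (unaryEncodeNat l.length) (boolPair (e a₁) (boolPair (e a₂) (… [])))`; decoding uses
the unary length as fuel (`Literature.Computability.Complexity.listBoolDecode`). Deliberate dot-notation extension of
`Computability.Encoding`. [Arora–Barak 2009, §0.1 (tuples of strings)] [cite: AroraBarak2009, §0.1 (tuples of strings] -/
def listBool (e : Encoding α Bool) : Encoding (List α) Bool where
  encode l := boolPair (unaryEncodeNat l.length)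
    (l.foldr (fun a acc => boolPair (e.encode a) acc) [])
  decode w := listBoolDecode e (unaryDecodeNat (boolUnpair w).1) (boolUnpair w).2
  decode_encode l := by
    simp only [boolUnpair_boolPair, unary_decode_encode_nat]
    induction l with
    | nil => rfl
    | cons a l ih =>
      simp [listBoolDecode, boolUnpair_boolPair, e.decode_encode, ih]

/-- Dependent-pair encoding over `Bool` for an `ℕ`-indexed family: `⟨n, a⟩ ↦
boolPair (encodeNat n) ((e n).encode a)`. Deliberate dot-notation extension of
`Computability.Encoding`. [Arora–Barak 2009, §0.1] [cite: AroraBarak2009, §0.1] -/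
def sigmaBool {F : ℕ → Type} (e : ∀ n : ℕ, Encoding (F n) Bool) : Encoding (Σ n, F n) Bool where
  encode p := boolPair (encodeNat p.1) ((e p.1).encode p.2)
  decode w := sigmaBoolDecode e (decodeNat (boolUnpair w).1) (boolUnpair w).2
  decode_encode p := by
    obtain ⟨n, a⟩ := p
    change sigmaBoolDecode e (decodeNat (boolUnpair (boolPair (encodeNat n) _)).1)
      (boolUnpair (boolPair (encodeNat n) ((e n).encode a))).2 = _
    rw [boolUnpair_boolPair, decode_encodeNat]
    simp [sigmaBoolDecode]

/-- Option encoding over `Bool`: `none ↦ [false]`, `some a ↦ true :: e.encode a`.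
Deliberate dot-notation extension of `Computability.Encoding`. [Arora–Barak 2009, §0.1] [cite: AroraBarak2009, §0.1] -/
def optionBool (e : Encoding α Bool) : Encoding (Option α) Bool where
  encode
    | none => [false]
    | some a => true :: e.encode a
  decode
    | true :: w => (e.decode w).map some
    | _ => some none
  decode_encode o := by
    cases o with
    | none => rfl
    | some a => simp [e.decode_encode]

/-- Sum encoding over `Bool` with a tag bit: `inl a ↦ false :: ea.encode a`,
`inr b ↦ true :: eb.encode b`. Deliberate dot-notation extension of `Computability.Encoding`.
[Arora–Barak 2009, §0.1] [cite: AroraBarak2009, §0.1] -/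
def sumBool (ea : Encoding α Bool) (eb : Encoding β Bool) : Encoding (α ⊕ β) Bool where
  encode
    | Sum.inl a => false :: ea.encode a
    | Sum.inr b => true :: eb.encode b
  decode
    | false :: w => (ea.decode w).map Sum.inl
    | true :: w => (eb.decode w).map Sum.inr
    | [] => none
  decode_encode s := by
    cases s with
    | inl a => simp [ea.decode_encode]
    | inr b => simp [eb.decode_encode]

/-- The language of a math-level set `S ⊆ α` under a Boolean encoding `e`: the set of
encodings of members of `S`, `e.encode '' S : Language Bool`. Deliberate dot-notation extension
of `Computability.Encoding`. [Arora–Barak 2009, §1.2 (decision problems as languages)] [cite: AroraBarak2009, §1.2 (decision problems as languages] -/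
def toLanguage (e : Encoding α Bool) (S : Set α) : Language Bool := e.encode '' S

/-- Membership in `e.toLanguage S` of an encoded element is membership in `S` (by injectivity
of `e.encode`). [Mathlib `Computability.Encoding.encode_injective`] [folklore] -/
@[simp] theorem mem_toLanguage_iff (e : Encoding α Bool) (S : Set α) (a : α) :
    e.encode a ∈ e.toLanguage S ↔ a ∈ S :=
  e.encode_injective.mem_set_image

/-- `toLanguage` is monotone in the set. [Arora–Barak 2009, §1.2] [cite: AroraBarak2009, §1.2] -/
theorem toLanguage_mono (e : Encoding α Bool) {S T : Set α} (h : S ⊆ T) :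
    e.toLanguage S ≤ e.toLanguage T :=
  Set.image_mono h

/-- Complement of an encoded language: a string is outside `e.toLanguage S` iff it encodes an
element of `Sᶜ` or is not a code word at all. (Used for `coNP`-style statements.)
[Arora–Barak 2009, §2.6.1, remark on coNP and invalid encodings] [cite: AroraBarak2009, §2.6.1  remark on coNP and invalid encod] -/
theorem compl_toLanguage_eq (e : Encoding α Bool) (S : Set α) :
    (e.toLanguage S)ᶜ = e.toLanguage Sᶜ ⊔ ((Set.range e.encode)ᶜ : Set (List Bool)) := by
  change (e.encode '' S)ᶜ = e.encode '' Sᶜ ∪ (Set.range e.encode)ᶜ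
  ext w
  simp only [Set.mem_compl_iff, Set.mem_union, Set.mem_image, Set.mem_range, not_exists,
    not_and]
  constructor
  · intro h
    by_cases hw : ∃ a, e.encode a = w
    · obtain ⟨a, rfl⟩ := hw
      exact Or.inl ⟨a, fun ha => h a ha rfl, rfl⟩
    · exact Or.inr (not_exists.mp hw)
  · rintro (⟨a, ha, rfl⟩ | h) b hb hab
    · exact ha (e.encode_injective hab ▸ hb)
    · exact h b hab

end Computability.Encoding

/-- The `n`-th slice of a language `L ⊆ {0,1}*` as a Boolean function on `n` input bits:
`x ↦ [List.ofFn x ∈ L]`. Noncomputable (`Set.boolIndicator`). Deliberate dot-notation extension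
of Mathlib's `Language`. [Arora–Barak 2009, §6.1 (circuit families decide `L ∩ {0,1}ⁿ`)] [cite: AroraBarak2009, §6.1 (circuit families decide  L ∩ {0 1}] -/
noncomputable def Language.sliceFn (L : Language Bool) (n : ℕ) : (Fin n → Bool) → Bool :=
  fun x => L.boolIndicator (List.ofFn x)

namespace Literature.Computability.Complexity

open _root_.Computability

/-! ### Concrete encodings -/

/-- Integers over `Bool`: sign bit paired with the binary encoding of the absolute value,
`z ↦ boolPair (encodeBool (z < 0)) (encodeNat z.natAbs)` realised via `pairBool`, transported
along `ℤ ≃ Bool × ℕ`-style maps. [Arora–Barak 2009, §0.1] [cite: AroraBarak2009, §0.1] -/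
def encodingIntBool : Encoding ℤ Bool where
  encode z := (encodingBoolBool.pairBool encodingNatBool).encode (decide (z < 0), z.natAbs)
  decode w := ((encodingBoolBool.pairBool encodingNatBool).decode w).map
    fun p => if p.1 then -(p.2 : ℤ) else (p.2 : ℤ)
  decode_encode z := by
    rw [(encodingBoolBool.pairBool encodingNatBool).decode_encode]
    simp only [Option.map_some, Option.some.injEq]
    by_cases h : z < 0
    · simp only [h, decide_true, if_true, Int.ofNat_natAbs_of_nonpos h.le, neg_neg]
    · simp only [h, decide_false, if_false, Bool.false_eq_true,
        Int.natAbs_of_nonneg (not_lt.mp h)]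

/-- `Fin n` over `Bool`: binary encoding of the value; decoding checks the bound.
[Arora–Barak 2009, §0.1] [cite: AroraBarak2009, §0.1] -/
def encodingFinBool (n : ℕ) : Encoding (Fin n) Bool where
  encode i := encodeNat i.val
  decode w := if h : decodeNat w < n then some ⟨decodeNat w, h⟩ else none
  decode_encode i := by simp [decode_encodeNat, i.isLt]

/-- Bit vectors `Fin n → Bool` over `Bool`: the identity-like encoding `List.ofFn`; decoding
checks the length. [Arora–Barak 2009, §6.1 (inputs in `{0,1}ⁿ`)] [cite: AroraBarak2009, §6.1 (inputs in  {0 1}ⁿ] -/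
def encodingBitVec (n : ℕ) : Encoding (Fin n → Bool) Bool where
  encode x := List.ofFn x
  decode w := if h : w.length = n then some (fun i => w.get (i.cast h.symm)) else none
  decode_encode x := by
    simp only [List.length_ofFn, dite_true, Option.some.injEq]
    funext i
    simp

/-- Lists of naturals over `Bool` (`encodingNatBool.listBool`). Named `encodingListNatBool`
because `Literature.Computability.Cryptography.encodingListNat` (alphabet `Option Bool`) already exists.
[Arora–Barak 2009, §0.1] [cite: AroraBarak2009, §0.1] -/
abbrev encodingListNatBool : Encoding (List ℕ) Bool := encodingNatBool.listBool

/-! ### Sanity: pairing and projections are polynomial-time -/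

/-- The pairing map `(x, y) ↦ boolPair x y` is polynomial-time computable when the input pair
is itself presented via `boolPair` (i.e. w.r.t. `(encodingList Bool).pairBool (encodingList
Bool)`); the machine is the identity. [Arora–Barak 2009, §1.2; Mathlib
`Turing.idComputableInPolyTime`] [cite: AroraBarak2009, §1.2] -/
def polyTimeComputable_boolPair : Prop :=
  PolyTimeComputable ((encodingList Bool).pairBool (encodingList Bool)).encode
      (encodingList Bool).encode (Function.uncurry boolPair)

/-- The first projection of a `boolPair`-encoded pair of strings is polynomial-time computable
(halve the doubled prefix up to the separator). [Arora–Barak 2009, §0.1, §1.2] [cite: AroraBarak2009, §0.1  §1.2] -/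
def polyTimeComputable_fst : Prop :=
  PolyTimeComputable ((encodingList Bool).pairBool (encodingList Bool)).encode
      (encodingList Bool).encode (Prod.fst : List Bool × List Bool → List Bool)

/-- The second projection of a `boolPair`-encoded pair of strings is polynomial-time computable
(skip to the separator, copy the rest). [Arora–Barak 2009, §0.1, §1.2] [cite: AroraBarak2009, §0.1  §1.2] -/
def polyTimeComputable_snd : Prop :=
  PolyTimeComputable ((encodingList Bool).pairBool (encodingList Bool)).encode
      (encodingList Bool).encode (Prod.snd : List Bool × List Bool → List Bool)

end Literature.Computability.Complexity

/-! ### Bit strings as numbers (least significant bit first) -/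

namespace Literature.Computability.Complexity

open _root_.Computability

/-- The number with binary digits `l`, least significant digit first: `bitsToNat [] = 0`,
`bitsToNat (b :: l) = b + 2 · bitsToNat l`. A *total* left inverse of Mathlib's `encodeNat`
(`bitsToNat_encodeNat`), insensitive to redundant high zeros (unlike `decodeNat`, whose values on
non-canonical strings are irregular), hence suited to input parsers that must accept every
string. This is the CANONICAL copy of the notion (this file is upstream of every user); the
tree currently holds two duplicates, to be retired into aliases of
this one: `Literature.Computability.Cryptography.bitsVal` (`Literature/Computability/Cryptography/
LiuPassWeakOWF.lean:72`, the same recursion verbatim) and `Literature.SIS.bitsToNat l = Nat.ofDigits 2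
(l.map fun b => cond b 1 0)` (`Literature/Computability/Cryptography/SISFunction.lean:339`,
extensionally equal: unfolding `Nat.ofDigits_cons` gives the same recursion; `Nat.ofDigits` is
not imported here). Until the SIS copy is retired, `open Literature.CplxCore Literature.SIS` makes the bare
name ambiguous. [Arora–Barak 2009, §0.1 (binary representation)] [folklore] -/
def bitsToNat : List Bool → ℕ
  | [] => 0
  | b :: l => b.toNat + 2 * bitsToNat l

/-- Value of the empty string. [folklore] -/
@[simp] theorem bitsToNat_nil : bitsToNat [] = 0 := rfl

/-- Value of `b :: l`. [folklore] -/
@[simp] theorem bitsToNat_cons (b : Bool) (l : List Bool) :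
    bitsToNat (b :: l) = b.toNat + 2 * bitsToNat l :=
  rfl

/-- Value of a concatenation. [folklore] -/
theorem bitsToNat_append (v w : List Bool) :
    bitsToNat (v ++ w) = bitsToNat v + 2 ^ v.length * bitsToNat w := by
  induction v with
  | nil => simp
  | cons b v ih => simp [ih, pow_succ]; ring

/-- A string of zeros has value `0`. [folklore] -/
@[simp] theorem bitsToNat_replicate_false (n : ℕ) : bitsToNat (List.replicate n false) = 0 := by
  induction n with
  | zero => rfl
  | succ n ih => simp [List.replicate_succ, ih]

/-- The value is below `2^length`. [folklore] -/
theorem bitsToNat_lt (w : List Bool) : bitsToNat w < 2 ^ w.length := by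
  induction w with
  | nil => simp
  | cons b w ih => cases b <;> simp [pow_succ] <;> omega

/-- `bitsToNat` inverts Mathlib's positive binary numerals. [folklore] -/
theorem bitsToNat_encodePosNum (n : PosNum) : bitsToNat (encodePosNum n) = n := by
  induction n with
  | one => simp [encodePosNum]
  | bit0 n ih => simp only [encodePosNum, bitsToNat_cons, ih, PosNum.cast_bit0]; simp; ring
  | bit1 n ih => simp only [encodePosNum, bitsToNat_cons, ih, PosNum.cast_bit1]; simp; ring

/-- **`bitsToNat (encodeNat n) = n`.** [folklore] -/
@[simp] theorem bitsToNat_encodeNat (n : ℕ) : bitsToNat (encodeNat n) = n := by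
  have h : ((n : Num) : ℕ) = n := Num.to_of_nat n
  unfold encodeNat encodeNum
  cases hn : (n : Num) with
  | zero => rw [hn] at h; rw [← h]; rfl
  | pos m =>
    rw [hn, Num.cast_pos] at h
    conv_rhs => rw [← h]
    exact bitsToNat_encodePosNum m

end Literature.Computability.Complexity
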